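import Summits.ValiantsHypothesis.ValiantsHypothesis.Theorems.LacunarySymmetroidMatrixDescartesRangeObligations
import Literature.Algebra.Polynomial.ErdosTuranPositiveZerosProofs

/-!
# `MatrixDescartes` — line «range» §9 over the NAMED Erdős–Turán fact: the violator structure conditional on
# `Literature.Algebra.Polynomial.ErdosTuran1950_positiveZeros` only

HONEST FRAMING.  Helper file (`--supports stmt-ValiantsHypothesis-18050 --as helper`; porter val-port-4 g1, val-lit merged desk g11
RULING #250 (a)).  `…RangeObligations.violator_degree` (p607620) takes the Erdős–Turán inequality on the positive axis as an explicit
`Prop` binder `hET`; since then the literature layer typed the published theorem — `Literature.Algebra.Polynomial.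
ErdosTuran1950_positiveZeros` (val-lit-p9 g0, p609585: Erdős–Turán, Ann. of Math. 51 (1950), via Milovanović–Rassias 2000, §5
Thm 5.1, `p² ≤ 2 n log R` over `ℂ[X]`; a NAMED FACT, typed and NOT proved in the tree) — and PROVED the bridge
`ErdosTuran1950_positiveZeros.positiveAxis` (`…ErdosTuranPositiveZerosProofs`), which is `hET` token for token with `l1` unfolded.
This file composes the two BY NAME, so that the violator structure of line «range» §9 is a tree theorem CONDITIONAL ON THAT ONE
NAMED FACT (a `conditional-result` in the gate's sense; discharging `ErdosTuran1950_positiveZeros` is a literature-prover's job, not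
attempted here).  Crux `Summit.ValiantsHypothesis.ValiantsHypothesis.Theses.LacunarySymmetroid.MatrixDescartes`
(stmt-ValiantsHypothesis-18050): nothing here bears on it, on Conjecture B at `m = 2`, or on `VP ≠ VNP`; no Theses import.
[folklore] composition only.
-/

-- `Summit.ValiantsHypothesis.ValiantsHypothesis.…` repeats a component by the D-0017 layout
-- (single-conjunct summit), which the `dupNamespace` linter flags; the name is mandated.
set_option linter.dupNamespace false

noncomputable section

namespace Summit.ValiantsHypothesis.ValiantsHypothesis.Theorems.LacunarySymmetroidMatrixDescartes.RangeObligations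

open scoped BigOperators Matrix
open Polynomial
open Summit.ValiantsHypothesis.ValiantsHypothesis.Theorems.LacunarySymmetroidMatrixDescartes.FiniteSector
open Literature.Algebra.Polynomial

/-- The line's obligation «Erdős–Turán on the positive axis» (the binder `hET` of `violator_degree`, with `…FiniteSector.l1`)
follows from the NAMED fact `ErdosTuran1950_positiveZeros` through its proved bridge `.positiveAxis` (val-lit-p9 g0). [folklore] -/
theorem erdosTuranPositiveAxis_of (h : ErdosTuran1950_positiveZeros) :
    ∀ q : ℝ[X], q.coeff 0 ≠ 0 →
      (((q.roots.filter (0 < ·)).toFinset.card : ℕ) : ℝ) ^ 2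
        ≤ 256 * q.natDegree * Real.log (l1 q / Real.sqrt |q.coeff 0 * q.leadingCoeff|) :=
  h.positiveAxis

/-- **Violator structure, conditional on Erdős–Turán 1950 only.**  Assuming the typed published theorem
`ErdosTuran1950_positiveZeros`, every lacunary pencil `P = Σ_l X^{d l} S_l` with real letters bounded by `h'` and integer-like
ends `|c₀·lc| ≥ 1` has `Z₊(det P)² ≤ 256 · deg(det P) · log(m!·(K h')^m)` — the composition of `violator_degree` (whose routine
hypothesis `DetL1Bound` is proved in `…RangeObligations`) with the bridge `erdosTuranPositiveAxis_of`.  CONDITIONAL on the named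
fact; nothing else is assumed. [folklore] -/
theorem violator_degree_of_erdosTuran1950 (h : ErdosTuran1950_positiveZeros) {m K : ℕ} (d : Fin K → ℕ)
    (S : Fin K → Matrix (Fin m) (Fin m) ℝ) {h' : ℝ} (hS : ∀ l i j, |S l i j| ≤ h')
    (hends : 1 ≤ |(pencil d S).det.coeff 0 * (pencil d S).det.leadingCoeff|) :
    ((((pencil d S).det.roots.filter (0 < ·)).toFinset.card : ℕ) : ℝ) ^ 2
      ≤ 256 * (pencil d S).det.natDegree * Real.log ((m.factorial : ℝ) * (K * h') ^ m) :=
  violator_degree (erdosTuranPositiveAxis_of h) d S hS hends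

/-- Division form, conditional on Erdős–Turán 1950 only: with height budget `m!·(K h')^m > 1`,
`deg(det P) ≥ Z₊² / (256 · log(m!·(K h')^m))` — degree waste quadratic in the positive-root count. [folklore] -/
theorem violator_natDegree_ge_of_erdosTuran1950 (h : ErdosTuran1950_positiveZeros) {m K : ℕ} (d : Fin K → ℕ)
    (S : Fin K → Matrix (Fin m) (Fin m) ℝ) {h' : ℝ} (hS : ∀ l i j, |S l i j| ≤ h')
    (hends : 1 ≤ |(pencil d S).det.coeff 0 * (pencil d S).det.leadingCoeff|)
    (hbudget : 1 < (m.factorial : ℝ) * (K * h') ^ m) :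
    ((((pencil d S).det.roots.filter (0 < ·)).toFinset.card : ℕ) : ℝ) ^ 2
        / (256 * Real.log ((m.factorial : ℝ) * (K * h') ^ m))
      ≤ (pencil d S).det.natDegree :=
  violator_natDegree_ge (erdosTuranPositiveAxis_of h) d S hS hends hbudget

end Summit.ValiantsHypothesis.ValiantsHypothesis.Theorems.LacunarySymmetroidMatrixDescartes.RangeObligations

end
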